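import Summits.FinalStateConjecture.FinalStateConjecture.Theorems.KerrShieldedSettles.Negative.OrientationAndHoleCollar
import Summits.FinalStateConjecture.FinalStateConjecture.Theorems.StarvedNecksHonestFixedRadiusSettlingStubFarExitEnergy
import Literature.Geometry.Lorentzian.KerrWaveEnergy
import Literature.Geometry.Lorentzian.KerrSchildCoord
import HarnessLib

/-!
# `KerrShieldedSettles`, line `tapered-temporal-collar` — stub S4 `stub_kerrLeafSojourn`, part 1:
# pointwise two-speed optics of the ingoing Kerr–Schild chart and chart kinematics

Support file for crux `stmt-FinalStateConjecture-10054`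
(`Summit.FinalStateConjecture.FinalStateConjecture.Theses.SwallowTheDatum.KerrShieldedSettles`), stub
`stub_kerrLeafSojourn` (every normalised future null ray from a far-out point of the bent leaf is future
complete in the chart or banks a long sojourn in the causal future of a compact piece of the leaf).
This part is the POINTWISE Kerr–Schild linear algebra of `g = η + 2H ℓ ⊗ ℓ` (`Kerr.bilin_apply`) used
along the ray, on top of the sibling crux's `FarExitEnergy` (`ks_apply_self`, `ks_apply_basisVector_zero`,
`abs_nullCovector_sub_le`: `ℓ(w) = w⁰ + ℓ⃗·w⃗`, `|ℓ⃗·w⃗| ≤ |w⃗|`):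

* `energy_pinch`: the Killing energy `e(w) = −g(w, ∂_{t*}) = w⁰ − 2Hℓ(w)` of a causal `w` with
  `w⁰ ≥ 0` satisfies `(1 − 4H) w⁰ ≤ e(w) ≤ w⁰` (outer cone `|w⃗| ≤ w⁰`, `spatial_sq_le_of_causal`);
* `bilin_self_neg_of_cone` (inner cone): on `{r ≥ 8M}` (`2H ≤ 1/4`) a vector with `w⁰ > 0` and
  `2|w⃗| ≤ w⁰` is timelike;
* bookkeeping: `‖w‖² = (w⁰)² + |w⃗|²`, `‖w‖ ≤ 2w⁰` when `|w⃗| ≤ w⁰`, `‖x⃗‖ − |a| ≤ r`, and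
  `w⁰ = 0 ⇒ w = 0` for causal `w`;
* chart kinematics of a coordinate curve obeying the speed limit `|ẋ⃗| ≤ ṫ* ≤ B`: elapsed coordinate
  time `≤ B Δλ` and the curve is `2B`-Lipschitz (mean value inequalities).

References: Kerr–Schild 1965, §2; Visser arXiv:0706.0622, (32)–(35); Dafermos–Rodnianski
arXiv:0811.0354, §5.1 (ingoing Kerr–Schild chart); O'Neill 1983, Ch. 5, p. 145 and Ch. 14, p. 415.
-/

set_option linter.dupNamespace false

noncomputable section

open Set Filter
open scoped Manifold ContDiff Topology
open Literature.Geometry.Lorentzian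
open Summit.FinalStateConjecture.FinalStateConjecture.Theorems.KerrShieldedSettles.Negative
  (spatial_sq_le_of_causal)
open Summit.FinalStateConjecture.FinalStateConjecture.Theorems.StarvedNecks.OneOverDelta.FarEnd
  (ks_apply_self ks_apply_basisVector_zero abs_nullCovector_sub_le)

namespace Summit.FinalStateConjecture.FinalStateConjecture.Theorems.SwallowTheDatum.KerrShieldedSettles

namespace KerrLeafSojourn

/-! ## Pointwise optics of `g = η + 2H ℓ ⊗ ℓ` -/

/-- `H ≤ 1/k` on `{r ≥ kM}` (`k > 0`; `H ≤ M/r`, `Kerr.scalarH_le_div`). [folklore] -/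
theorem scalarH_le_inv {M : ℝ} (hM : 0 ≤ M) (a : ℝ) {x : E4} (hx : 0 < Kerr.radius a x) {k : ℝ}
    (hk : 0 < k) (hr : k * M ≤ Kerr.radius a x) : Kerr.scalarH M a x ≤ 1 / k := by
  refine (Kerr.scalarH_le_div hM a hx).trans ?_
  rw [div_le_div_iff₀ hx hk]
  linarith

/-- **Energy pinch.** For a causal `w` with `w⁰ ≥ 0` at a point with `r > 0` (`M ≥ 0`), the Killing
energy `e = −g(w, ∂_{t*}) = w⁰ − 2Hℓ(w)` satisfies `(1 − 4H) w⁰ ≤ e ≤ w⁰` (since `0 ≤ ℓ(w) ≤ 2w⁰`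
by the outer cone `|w⃗| ≤ w⁰`). Dafermos–Rodnianski arXiv:0811.0354, §5.1. [cite: arXiv08110354, §5.1] -/
theorem energy_pinch {M : ℝ} (hM : 0 ≤ M) (a : ℝ) {x : E4} (hx : 0 < Kerr.radius a x) {w : E4}
    (hc : Kerr.bilin M a x w w ≤ 0) (hw : 0 ≤ w 0) :
    (1 - 4 * Kerr.scalarH M a x) * w 0 ≤ -Kerr.bilin M a x w (E4.basisVector 0) ∧
      -Kerr.bilin M a x w (E4.basisVector 0) ≤ w 0 := by
  have hsp := spatial_sq_le_of_causal hM a x w hc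
  rw [← E4.spatialNorm_sq] at hsp
  have hsp' : E4.spatialNorm w ≤ w 0 := (abs_le_of_sq_le_sq' hsp hw).2
  have hp := abs_le.1 ((abs_nullCovector_sub_le hx w).trans hsp')
  have hH := Kerr.scalarH_nonneg hM a x
  rw [ks_apply_basisVector_zero]
  constructor
  · nlinarith [mul_le_mul_of_nonneg_left hp.2 hH]
  · nlinarith [mul_nonneg hH (show 0 ≤ Kerr.nullCovector a x w by linarith [hp.1])]

/-- **Inner cone**: on `{r ≥ 8M}` (`2H ≤ 2M/r ≤ 1/4`), a vector with `w⁰ > 0` and `2|w⃗| ≤ w⁰` is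
timelike, `g(w, w) ≤ −(w⁰)² + |w⃗|² + 2H(w⁰ + |w⃗|)² ≤ −(3/16)(w⁰)² < 0`. [folklore] -/
theorem bilin_self_neg_of_cone {M : ℝ} (hM : 0 ≤ M) (a : ℝ) {x : E4} (hx : 0 < Kerr.radius a x)
    (hr : 8 * M ≤ Kerr.radius a x) {w : E4} (hw : 0 < w 0)
    (hsp : 4 * (w 1 ^ 2 + w 2 ^ 2 + w 3 ^ 2) ≤ (w 0) ^ 2) : Kerr.bilin M a x w w < 0 := by
  have hH := Kerr.scalarH_nonneg hM a x
  have hH8 : Kerr.scalarH M a x ≤ 1 / 8 := scalarH_le_inv hM a hx (by norm_num) hr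
  have hCS := abs_le.1 (abs_nullCovector_sub_le hx w)
  have hN := E4.spatialNorm_sq w
  have hN0 := E4.spatialNorm_nonneg w
  set l := Kerr.nullCovector a x w with hl
  set N := E4.spatialNorm w
  -- `N ≤ w⁰/2`, `|l - w⁰| ≤ N`, so `l² ≤ (9/4) (w⁰)²`
  have hN2 : N ≤ w 0 / 2 := (abs_le_of_sq_le_sq' (by nlinarith) (by linarith)).2
  have hl2 : l ^ 2 ≤ 9 / 4 * (w 0) ^ 2 := by nlinarith [hCS.1, hCS.2]
  rw [ks_apply_self]
  nlinarith [mul_le_mul_of_nonneg_right hH8 (sq_nonneg l), mul_le_mul_of_nonneg_left hl2 hH]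

/-- A causal vector with vanishing time component vanishes (`|w⃗| ≤ w⁰`). [folklore] -/
theorem eq_zero_of_causal_of_apply_zero {M : ℝ} (hM : 0 ≤ M) (a : ℝ) (x : E4) {w : E4}
    (hc : Kerr.bilin M a x w w ≤ 0) (h0 : w 0 = 0) : w = 0 := by
  have hsp := spatial_sq_le_of_causal hM a x w hc
  rw [h0] at hsp
  have h1 : w 1 = 0 := by nlinarith [sq_nonneg (w 1), sq_nonneg (w 2), sq_nonneg (w 3)]
  have h2 : w 2 = 0 := by nlinarith [sq_nonneg (w 1), sq_nonneg (w 2), sq_nonneg (w 3)]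
  have h3 : w 3 = 0 := by nlinarith [sq_nonneg (w 1), sq_nonneg (w 2), sq_nonneg (w 3)]
  ext μ
  fin_cases μ
  · exact h0
  · exact h1
  · exact h2
  · exact h3

/-! ## Euclidean bookkeeping in the chart -/

/-- `‖w‖² = (w⁰)² + |w⃗|²` for the (topological) Euclidean norm of `E4`. [folklore] -/
theorem norm_sq_eq (w : E4) : ‖w‖ ^ 2 = w 0 ^ 2 + (w 1 ^ 2 + w 2 ^ 2 + w 3 ^ 2) := by
  rw [EuclideanSpace.real_norm_sq_eq]
  simp only [Fin.sum_univ_four, Fin.isValue]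
  ring

/-- A vector whose spatial part is bounded by its time component has chart norm `≤ 2w⁰`. [folklore] -/
theorem norm_le_two_mul_of_spatial_le {w : E4} (hw : ‖E4.spatial w‖ ≤ w 0) : ‖w‖ ≤ 2 * w 0 := by
  have h0 : 0 ≤ w 0 := (norm_nonneg _).trans hw
  have h1 : ‖E4.spatial w‖ ^ 2 ≤ (w 0) ^ 2 := pow_le_pow_left₀ (norm_nonneg _) hw 2
  rw [show ‖E4.spatial w‖ = E4.spatialNorm w from rfl, E4.spatialNorm_sq] at h1
  have h2 : ‖w‖ ^ 2 ≤ (2 * w 0) ^ 2 := by rw [norm_sq_eq]; nlinarith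
  exact (abs_le_of_sq_le_sq' h2 (by linarith)).2

/-- **Outer cone, norm form**: a causal `w` with `w⁰ ≥ 0` has `‖E4.spatial w‖ ≤ w⁰`. [folklore] -/
theorem norm_spatial_le_of_causal {M : ℝ} (hM : 0 ≤ M) (a : ℝ) (x : E4) {w : E4}
    (hc : Kerr.bilin M a x w w ≤ 0) (hw : 0 ≤ w 0) : ‖E4.spatial w‖ ≤ w 0 := by
  have hsp := spatial_sq_le_of_causal hM a x w hc
  rw [← E4.spatialNorm_sq] at hsp
  exact (abs_le_of_sq_le_sq' hsp hw).2

/-- **`‖x⃗‖ − |a| ≤ r`** (`‖x⃗‖² − a² ≤ r²`, `Kerr.spatialNorm_sq_sub_sq_le_radius_sq`). [folklore] -/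
theorem spatialNorm_sub_le_radius (a : ℝ) (x : E4) :
    E4.spatialNorm x - |a| ≤ Kerr.radius a x := by
  have h := Kerr.spatialNorm_sq_sub_sq_le_radius_sq a x
  have hr := Kerr.radius_nonneg a x
  have h2 : E4.spatialNorm x ^ 2 ≤ (Kerr.radius a x + |a|) ^ 2 := by
    nlinarith [sq_abs a, mul_nonneg hr (abs_nonneg a)]
  linarith [(abs_le_of_sq_le_sq' h2 (by positivity)).2]

/-! ## Kinematics of chart curves obeying the speed limit `|ẋ⃗| ≤ ṫ* ≤ B`

For a coordinate curve `c : ℝ → E4` with derivative `v` on an interval `s`: a bound `(v t)⁰ ≤ B`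
bounds the elapsed coordinate time by `B ×` the elapsed parameter, and together with
`‖(v t)⃗‖ ≤ (v t)⁰` makes `c` `2B`-Lipschitz (mean value inequalities).  Monotonicity of the time
coordinate and the displacement bound `‖Δx⃗‖ ≤ Δt*` are the sibling crux's
`OneOverDelta.Kinematics.monotone_time` / `displacement_le`.  O'Neill 1983, Ch. 5, p. 145 and
Ch. 14, p. 415 (integrated light-cone bound). -/

section Kinematics

variable {c v : ℝ → E4} {s : Set ℝ}

/-- **Elapsed coordinate time is bounded by `B ×` affine time** when `(v t)⁰ ≤ B` on `s` (mean value
inequality). [folklore] -/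
theorem time_sub_le_mul (hs : s.OrdConnected) (hc : ∀ t ∈ s, HasDerivAt c (v t) t) {B : ℝ}
    (hB : ∀ t ∈ s, v t 0 ≤ B) {σ₁ σ₂ : ℝ} (h₁ : σ₁ ∈ s) (h₂ : σ₂ ∈ s) (h12 : σ₁ ≤ σ₂) :
    c σ₂ 0 - c σ₁ 0 ≤ B * (σ₂ - σ₁) := by
  have hd : ∀ t ∈ s, HasDerivAt (fun σ ↦ c σ 0) (v t 0) t := fun t ht ↦
    ((EuclideanSpace.proj (0 : Fin 4) : E4 →L[ℝ] ℝ).hasFDerivAt.comp_hasDerivAt t (hc t ht))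
  exact hs.convex.image_sub_le_mul_sub_of_deriv_le
    (fun t ht ↦ (hd t ht).continuousAt.continuousWithinAt)
    (fun t ht ↦ (hd t (interior_subset ht)).differentiableAt.differentiableWithinAt)
    (fun t ht ↦ by rw [(hd t (interior_subset ht)).deriv]; exact hB t (interior_subset ht))
    σ₁ h₁ σ₂ h₂ h12

/-- **The curve is `2B`-Lipschitz** when `|(v t)⃗| ≤ (v t)⁰ ≤ B` on `s`. [folklore] -/
theorem norm_sub_le_mul (hs : s.OrdConnected) (hc : ∀ t ∈ s, HasDerivAt c (v t) t)
    (hv : ∀ t ∈ s, ‖E4.spatial (v t)‖ ≤ v t 0) {B : ℝ} (hB : ∀ t ∈ s, v t 0 ≤ B) {σ₁ σ₂ : ℝ}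
    (h₁ : σ₁ ∈ s) (h₂ : σ₂ ∈ s) : ‖c σ₂ - c σ₁‖ ≤ 2 * B * |σ₂ - σ₁| := by
  have h := hs.convex.norm_image_sub_le_of_norm_hasDerivWithin_le (f := c) (f' := v) (C := 2 * B)
    (fun t ht ↦ (hc t ht).hasDerivWithinAt)
    (fun t ht ↦ (norm_le_two_mul_of_spatial_le (hv t ht)).trans (by linarith [hB t ht])) h₁ h₂
  rwa [← Real.norm_eq_abs]

end Kinematics

end KerrLeafSojourn

open KerrLeafSojourn in
/-- **Registered sub-goal `stub_kerrLeafSojournOptics` (two-speed optics of the ingoing Kerr–Schild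
chart, pointwise).**  At a point with `r > 0` (`M ≥ 0`): (i) the Killing energy of a causal vector
`w` with `w⁰ ≥ 0` is pinched, `(1 − 4H) w⁰ ≤ −g(w, ∂_{t*}) ≤ w⁰`; (ii) on `{r ≥ 8M}` every vector with
`w⁰ > 0` and `2|w⃗| ≤ w⁰` is timelike.  Together with the outer cone `|w⃗| ≤ w⁰`
(`spatial_sq_le_of_causal`) this is the pointwise engine of `stub_kerrLeafSojourn`.
Dafermos–Rodnianski arXiv:0811.0354, §5.1; Kerr–Schild 1965, §2. [cite: arXiv08110354, §5.1] -/
theorem stub_kerrLeafSojournOptics : ∀ (M a : ℝ), 0 ≤ M → ∀ (x : E4), 0 < Kerr.radius a x →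
    ∀ (w : E4),
      (Kerr.bilin M a x w w ≤ 0 → 0 ≤ w 0 →
        (1 - 4 * Kerr.scalarH M a x) * w 0 ≤ -Kerr.bilin M a x w (E4.basisVector 0) ∧
          -Kerr.bilin M a x w (E4.basisVector 0) ≤ w 0) ∧
      (8 * M ≤ Kerr.radius a x → 0 < w 0 → 4 * (w 1 ^ 2 + w 2 ^ 2 + w 3 ^ 2) ≤ (w 0) ^ 2 →
        Kerr.bilin M a x w w < 0) :=
  fun _ a hM _ hx _ ↦ ⟨fun hc hw ↦ energy_pinch hM a hx hc hw,
    fun hr hw hsp ↦ bilin_self_neg_of_cone hM a hx hr hw hsp⟩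

end Summit.FinalStateConjecture.FinalStateConjecture.Theorems.SwallowTheDatum.KerrShieldedSettles

end
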